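import Summits.BirchSwinnertonDyer.BirchSwinnertonDyer.Theorems.GoldfeldAllTwistsTwoConverseTwinAdditiveTwoPrimesTwistDescentPOne
import Summits.BirchSwinnertonDyer.BirchSwinnertonDyer.Theorems.GoldfeldAllTwistsTwoConverseTwinQuarterTraceOfPrintPOneOfPrint
import Literature.NumberTheory.EllipticCurves.CasselsTateParity
import Literature.Algebra.Module.AlternatingPairingParity
import HarnessLib

set_option linter.dupNamespace false -- namespace `…BirchSwinnertonDyer.BirchSwinnertonDyer…` is the cell's (D-0017 nested layout)
set_option autoImplicit false

/-!
# Twin″ (item 19140), cell C7, TRANCHE C7-3 file F11: `Ш(W/ℚ)[2^∞] = 0` for `W ≅ 49a1^{(−2qp)}` on C7, modulo print and Cassels–Tate,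
# and `BSD(W, 2) ⟺ #Ш_an(W)` is a `2`-adic unit

Cell `bsd-goldfeld`, seat `bsd-goldfeld-s1p-c3x` (gen 12); planner RULING (cccxxxviii) (3) «TRANCHE C7-3 (formula axis)», object F11.
`--supports stmt-BirchSwinnertonDyer-19140` as a HELPER. No definition, no `sorry`. BINDERS: the ELEVEN prints of the C7 rank axis
(`hCST hGZ h12 h44 h13 h14 hS31 hnew hM hBF hGZK`, file F6b `analyticRank_eq_one_twoPrimesTwist_betaPOne_of_print`) and the named fact
`hCT : WeierstrassCurve.exists_casselsTate_pairing` (bsd.S18; ADMISSIBLE per RULING (cccxxxviii) (3)).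

THE ARGUMENT. §1 (fact `hCT` only): for an elliptic curve `E` over a number field with `Ш(E/K)` FINITE, `#(Ш(E) ∩ H¹(K,E)[p]) = p^{2k}`:
`Ш[p^∞] = A` is finite, `#A[p] = #(A/pA)` (Literature `natCard_torsionBy_eq_natCard_modN`), `#(A/pA) = p^{2k}` by Cassels–Tate
(Literature `exists_natCard_modN_primaryComponent_sha hCT`), and `A[p] = Ш[p]` (Literature `natCard_torsionBy_primaryComponent`,
`natCard_torsionBy_addSubgroup`). §2 on C7: the rank
axis gives `rank W(ℚ) = 1` and `Ш(W)` finite (F6b); file F10 gives `#(Ш(W) ∩ H¹[2]) ≤ 2` from the `(4, 4)` descent; `4^k ≤ 2` forces `k = 0`: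
**`Ш(W/ℚ)[2] = 0`, hence `Ш(W)[2^∞] = ⊥`, `corank_{ℤ₂} Sel_{2^∞}(W) = 1`, and `BSD(W, 2) ⟺ ord₂ #Ш_an(W) = 0`** (tree
`bsdp_two_iff_shaAn_unit_of_forall_mem_sha`) — the algebraic half of the formula axis on C7. What remains for `BSD(W,2)` itself (successor
scope, NOT here): the `2`-adic unit statement for `#Ш_an(W)`, i.e. B⁗'s common road `bsdp_two_negTwoPrimesTwist_of_traceHalving` re-proved on
C7 (its halvability and trace inputs use `#S = 2` and `p ≡ 5 (8)`, false resp. absent on C7).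
HONEST FRAMING: no `BSD(W,2)` is proved; BSD is not proved by any of this; item 19140 stays open; twist-density zero.

References: [SilvermanAEC2009] Thm. X.4.2, X.4.14; [MilneADT2006] I.6.13(a), I.6.26; [Miller2011LMS] Def. 1.1.
-/

noncomputable section

open scoped Classical

open WeierstrassCurve Literature.NumberTheory Literature.NumberTheory.EllipticCurves
  Literature.NumberTheory.EllipticCurves.ModularForms Literature.NumberTheory.EllipticCurves.CaiShuTian2014
  Literature.NumberTheory.EllipticCurves.CoatesLiTianZhai2015

namespace Summit.BirchSwinnertonDyer.BirchSwinnertonDyer.Theorems.GoldfeldGoodTwists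

/-! ## §1 Cassels–Tate for a finite `Ш`: `#Ш[p]` is an even power of `p` -/

section CasselsTate

variable {K : Type} [Field K] [NumberField K] (E : WeierstrassCurve K)

variable [E.IsElliptic]

/-- **Cassels–Tate for a FINITE `Ш`: `#(Ш(E/K) ∩ H¹(K,E)[p]) = p^{2k}`.** With `A = Ш[p^∞]` finite: `#Ш[p] = #A[p] = #(A/pA) = p^{2k}`
(Literature `natCard_torsionBy_eq_natCard_modN`, `exists_natCard_modN_primaryComponent_sha hCT`). Classically `Ш ≅ M ⊕ M`.
[cite: SilvermanAEC2009, Thm. X.4.14] [cite: MilneADT2006, I.6.13(a) and I.6.26] -/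
theorem exists_natCard_sha_inf_torsionBy_eq_pow_two_mul (hCT : exists_casselsTate_pairing (K := K)) (hfin : Finite E.sha)
    (p : ℕ) [Fact p.Prime] :
    ∃ k : ℕ, Nat.card (E.sha ⊓ AddSubgroup.torsionBy E.galH1 (p : ℕ) : AddSubgroup E.galH1) = p ^ (2 * k) := by
  haveI := hfin
  obtain ⟨k, hk⟩ := exists_natCard_modN_primaryComponent_sha E p hCT
  refine ⟨k, ?_⟩
  rw [← Literature.Algebra.Module.natCard_torsionBy_addSubgroup E.sha (p : ℤ),
    ← Literature.Algebra.Module.natCard_torsionBy_primaryComponent,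
    Literature.GroupTheory.FiniteAbelian.natCard_torsionBy_eq_natCard_modN p, hk]

/-- **Corollary: finite `Ш` and `#(Ш ∩ H¹[p]) ≤ p` force `Ш[p] = 0`** (`p^{2k} ≤ p < p²` ⇒ `k = 0`). [folklore] -/
theorem forall_mem_sha_smul_eq_zero_of_natCard_le (hCT : exists_casselsTate_pairing (K := K)) (hfin : Finite E.sha)
    (p : ℕ) [Fact p.Prime] (hle : Nat.card (E.sha ⊓ AddSubgroup.torsionBy E.galH1 (p : ℕ) : AddSubgroup E.galH1) ≤ p) :
    ∀ c ∈ E.sha, p • c = 0 → c = 0 := by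
  have hp : p.Prime := Fact.out
  obtain ⟨k, hk⟩ := exists_natCard_sha_inf_torsionBy_eq_pow_two_mul E hCT hfin p
  have hk0 : k = 0 := by
    by_contra h
    have h2 : p ^ 2 ≤ p ^ (2 * k) := Nat.pow_le_pow_right hp.pos (by omega)
    have hp2 : p < p ^ 2 := by nlinarith [hp.two_le]
    omega
  rw [hk0, mul_zero, pow_zero] at hk
  have hbot := AddSubgroup.eq_bot_of_card_eq _ hk
  intro c hc hpc
  have hmem : c ∈ (E.sha ⊓ AddSubgroup.torsionBy E.galH1 (p : ℕ) : AddSubgroup E.galH1) :=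
    AddSubgroup.mem_inf.mpr ⟨hc, AddSubgroup.torsionBy.nsmul_iff.mpr hpc⟩
  rw [hbot] at hmem
  exact AddSubgroup.mem_bot.mp hmem

end CasselsTate

/-! ## §2 Cell C7: `Ш(W)[2^∞] = 0` and the `2`-adic unit criterion for `BSD(W, 2)` -/

section C7

variable (hCST : thm11_ringClassChar)
  (hGZ : ∀ (N : ℕ) [NeZero N] (W : WeierstrassCurve ℚ) (K : Type) [Field K] [NumberField K], gross_zagier N W K)
  (h12 : thm12_fullBSD_twist) (h44 : thm44_ord_two_LAlg) (h13 : thm13_ord_two_LAlg) (h14 : thm14_rankOne_twist)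
  (hS31 : bsdTriple_of_rank_le_one_of_conductor_lt) (hnew : exists_isNewformOf) (hM : OptimalCurveManinCertificate cm7)
  (hBF : bsdTriple_of_hasCM_of_L_one_ne_zero) (hGZK : rank_eq_analyticRank_of_analyticRank_le_one)
  (hCT : exists_casselsTate_pairing (K := ℚ))
include hCST hGZ h12 h44 h13 h14 hS31 hnew hM hBF hGZK hCT

/-- **`Ш(W/ℚ)[2] = 0` ON C7, modulo the eleven prints and Cassels–Tate.** For primes `q ≡ 7 (mod 8)`, `(q/7) = −1`, `p ≡ 1 (mod 8)`, `(−7/p) = +1`,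
`−7` a fourth power mod `p`, `(p/q) = −1`, and every elliptic `W/ℚ` with `C • W = X₀(49)^{(−2qp)}`: every `c ∈ Ш(W/ℚ)` with `2c = 0` vanishes
(F6b: rank one and `Ш` finite; F10: `#Ш[2] ≤ 2`; §1: `#Ш[2] = 4^k`). [cite: SilvermanAEC2009, Thm. X.4.2(a) and Thm. X.4.14]
[cite: CoatesLiTianZhai2015, Thm. 1.2 (p. 359) and 1.4] -/
theorem forall_mem_sha_two_smul_eq_zero_twoPrimesTwist_betaPOne_of_print
    {q p : ℕ} (hq : q.Prime) (hq8 : q % 8 = 7) (hq7 : jacobiSym q 7 = -1)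
    [Fact p.Prime] (hp8 : p % 8 = 1) (hp7 : legendreSym p (-7) = 1) (hβ : ∃ x : ZMod p, x ^ 4 = -7) (hpq : jacobiSym (p : ℤ) q = -1)
    (W : WeierstrassCurve ℚ) [W.IsElliptic] (C : VariableChange ℚ) (hC : C • W = cm7.quadraticTwist (-(2 * (q : ℚ) * p))) :
    ∀ c ∈ W.sha, 2 • c = 0 → c = 0 := by
  haveI : Fact (Nat.Prime 2) := ⟨Nat.prime_two⟩
  haveI := Fact.mk hq
  obtain ⟨-, hrk, hfin⟩ := analyticRank_eq_one_twoPrimesTwist_betaPOne_of_print hCST hGZ h12 h44 h13 h14 hS31 hnew hM hBF hGZK hq hq8 hq7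
    hp8 hp7 hβ hpq W C hC
  have hC' : C • W = cm7.quadraticTwist ((-2 * ((q : ℤ) * p) : ℤ) : ℚ) := by rw [hC]; push_cast; ring_nf
  have hle := natCard_sha_two_le_two_twoPrimesTwist_pOne hq8 hq7 hp8 hp7 hβ hpq W C hC' hrk
  exact forall_mem_sha_smul_eq_zero_of_natCard_le W hCT hfin 2 (by simpa using hle)

/-- **THE ALGEBRAIC HALF OF THE FORMULA AXIS ON C7, modulo the eleven prints and Cassels–Tate**: for every elliptic `W/ℚ` with
`C • W = X₀(49)^{(−2qp)}` on C7 — `Ш(W/ℚ)[2^∞] = ⊥`, `corank_{ℤ₂} Sel_{2^∞}(W/ℚ) = 1`, and **`BSD(W, 2) ⟺ #Ш_an(W)` is a `2`-adic unit**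
(tree `bsdp_two_iff_shaAn_unit_of_forall_mem_sha`, `r_an(W) = rank W(ℚ) = 1`). `BSD(W,2)` itself is NOT proved here.
[cite: Miller2011LMS, Def. 1.1] [cite: SilvermanAEC2009, Thm. X.4.2(a) and Thm. X.4.14] [cite: CoatesLiTianZhai2015, Thm. 1.2 (p. 359) and 1.4] -/
theorem sha_two_primary_eq_bot_and_bsdp_two_iff_twoPrimesTwist_betaPOne_of_print
    {q p : ℕ} (hq : q.Prime) (hq8 : q % 8 = 7) (hq7 : jacobiSym q 7 = -1)
    [Fact p.Prime] (hp8 : p % 8 = 1) (hp7 : legendreSym p (-7) = 1) (hβ : ∃ x : ZMod p, x ^ 4 = -7) (hpq : jacobiSym (p : ℤ) q = -1)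
    (W : WeierstrassCurve ℚ) [W.IsElliptic] (C : VariableChange ℚ) (hC : C • W = cm7.quadraticTwist (-(2 * (q : ℚ) * p))) :
    AddCommGroup.primaryComponent W.sha 2 = ⊥ ∧ W.selmerCorank 2 = 1 ∧
      (BSDp W 2 ↔ ∃ r : ℚ, shaAn W = (r : ℂ) ∧ padicValRat 2 r = 0) := by
  haveI : Fact (Nat.Prime 2) := ⟨Nat.prime_two⟩
  haveI := Fact.mk hq
  obtain ⟨har, hrk, -⟩ := analyticRank_eq_one_twoPrimesTwist_betaPOne_of_print hCST hGZ h12 h44 h13 h14 hS31 hnew hM hBF hGZK hq hq8 hq7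
    hp8 hp7 hβ hpq W C hC
  have h2 := forall_mem_sha_two_smul_eq_zero_twoPrimesTwist_betaPOne_of_print hCST hGZ h12 h44 h13 h14 hS31 hnew hM hBF hGZK hCT hq hq8 hq7
    hp8 hp7 hβ hpq W C hC
  obtain ⟨hbot, hiff⟩ := bsdp_two_iff_shaAn_unit_of_forall_mem_sha W h2 (hrk.trans har.symm)
  refine ⟨hbot, ?_, hiff⟩
  rw [W.selmerCorank_eq_mordellWeilRank_add_holds 2, hrk, W.shaCorank_eq_zero_of_forall 2 h2]

end C7

end Summit.BirchSwinnertonDyer.BirchSwinnertonDyer.Theorems.GoldfeldGoodTwists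

end
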